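import Mathlib
import Literature.Probability.RandomPlanarGeometry.HexSAW
import Summits.CriticalPhenomena.SAWScalingLimit.Theorems.SAWDefectDecoherenceObservableToSLEROrientation

/-!
# Objects of the line `bridge-gate-renewal` for the crux `ObservableToSLER` (stmt-CriticalPhenomena-14005)

Lead prover `prover-line-stmt-CriticalPhenomena-14005-0` (crux protocol; skeleton
`Summits/CriticalPhenomena/SAWScalingLimit/Cruxes/ObservableToSLER/Lines/bridge-gate-renewal.lean`,
crux-plan round 1, idea card `Cruxes/ObservableToSLER/Ideas/bridge-gate-renewal.md`).  This file only
DEFINES the objects the line's six registered stubs speak about — signed zigzag rows of the honeycomb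
lattice, lattice hexagons and their continuum carriers, the crosscut ("gate") of a domain through the
first-exit edge of a walk, its root side, clean flat windows, good gates, and the carved critical SAW
law — so that the stub files under `Theorems/` and the lead's skeleton share ONE copy of them
(precedent: `Theorems/SAWDevelopingMapHexTightReversalDefs.lean`).  No statement of the line is
asserted or even named here: the typed statements (`GateDecomposition`, `RenewalAccumulation`,
`HexObservableLimitR6`, `SLELawContinuity`, `CarvedToSLE`, `FullIdentification`) live, over these
objects, in the skeleton and (inlined) in the stub files.

* (`rowCoord i v`, `rowOf k v`, `skewCoord` — the zigzag-row / skew coordinates — are declared, with their API,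
  in the already landed `Theorems/SAWDefectDecoherenceObservableToSLEROrientation.lean`, imported here;
  `rowOf_zero` below: `rowOf 0 v = v.1 1` is the row function of `HexObservableLimitR`'s half-lattice clause);
* `hexBall c n` — the lattice hexagon of size `n` around `c`; `contHex δ c n` — its closed
  continuum carrier at mesh `δ` (a convex hexagon with sides on `𝕋`-lines);
* `gatePoint δ p q` — midpoint of the rescaled dual edge `{p, q}`; `gateCut Ω δ c n p q` — the crosscut
  of `Ω` through it (component of the gate point in `∂(contHex) ∩ Ω`); `gateSide` — the root side
  (component of `Ω ∖ gateCut` containing `δ c_p`); `sideVerts` — its lattice shadow;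
* `HasCleanWindow Ω δ ρ S p q` — the closed `ρ`-ball about `δ c_q` lies in `Ω` and membership in `S`
  is there EXACTLY a signed-row condition (the root clause of `HexObservableLimitR`, any orientation);
* `IsFirstExit`, `IsGoodGate`, `IsFirstGoodGate`, `GoodRenewalAt` — first exit of a vertex list from
  `hexBall c n` through `{p, q}`, single crossing of the gate + clean window, minimal good level;
* `carvedWeight Ω δ S u v`, `carvedLaw Ω δ S u v` — the critical weight / law of the SAWs of `Ω_δ`
  from `u` to `v` avoiding the vertex set `S` (the critical SAW of the lattice domain `Ω_δ ∖ S`).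

Sources: H. Kesten, J. Math. Phys. 4 (1963) §4 (bridges, renewal); N. Madras, G. Slade, The
Self-Avoiding Walk (1993) §4.2; T. Alberts, H. Duminil-Copin, arXiv:0909.0203 (bridge points / lines
of the restriction measure); H. Duminil-Copin, S. Smirnov, Ann. of Math. 175 (2012) (arXiv:1007.0575)
§4 (the critical hexagonal SAW `hexSAWLaw`); Ch. Pommerenke, Boundary Behaviour of Conformal Maps
(1992) §2.4 (crosscuts).  Deliberately NOT here: any statement or theorem of the line beyond the
bookkeeping identity `rowOf_zero`.
-/

noncomputable section

open scoped BigOperators Topology NNReal ENNReal Classical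
open Filter Set MeasureTheory Metric
open Literature.Probability.LatticeModels (HexVertex hexGraph hexCenter triZeta Site)
open Literature.Probability.RandomPlanarGeometry
open Literature.Probability.RandomPlanarGeometry.SAW

namespace Summit.CriticalPhenomena.SAWScalingLimit.Theorems.ObservableToSLER.BridgeGate

/-- The lattice hexagon of size `n` around the vertex `c` ("level `n`"): all three row coordinates
within `n` of those of `c`.  Its boundary consists of six flat zigzag sides. -/
def hexBall (c : HexVertex) (n : ℕ) : Set HexVertex :=
  {v | ∀ i : Fin 3, |rowCoord i v - rowCoord i c| ≤ n}

/-- The CLOSED continuum hexagon at mesh `δ` carrying the lattice hexagon `hexBall c n`: the union of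
the closed `δ𝕋`-triangles of its faces,
`{z | ∀ i, rowCoord i c - n ≤ skewCoord i (z/δ) ≤ rowCoord i c + n + 1}`.  Convex; its sides lie on
`𝕋`-lines of mesh `δ`. -/
def contHex (δ : ℝ) (c : HexVertex) (n : ℕ) : Set ℂ :=
  {z | ∀ i : Fin 3, (rowCoord i c : ℝ) - n ≤ skewCoord i (z / δ) ∧
    skewCoord i (z / δ) ≤ (rowCoord i c : ℝ) + n + 1}

/-- The gate point of the lattice edge `{p, q}` at mesh `δ`: the midpoint of the rescaled dual edge,
i.e. the point where it crosses the `𝕋`-line separating the two faces. -/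
def gatePoint (δ : ℝ) (p q : HexVertex) : ℂ :=
  (δ : ℂ) * (hexCenter p + hexCenter q) / 2

/-- The CROSSCUT of the domain `Ω` through the gate: the connected component, in
`∂(contHex δ c n) ∩ Ω`, of the gate point of `{p, q}` (an open arc of the hexagon boundary inside `Ω`
with its two ends on `∂Ω`; junk `∅` if the gate point is not on it). -/
def gateCut (Ω : Set ℂ) (δ : ℝ) (c : HexVertex) (n : ℕ) (p q : HexVertex) : Set ℂ :=
  connectedComponentIn (frontier (contHex δ c n) ∩ Ω) (gatePoint δ p q)

/-- The `p`-SIDE (root side) of the gate: the connected component of `Ω ∖ gateCut` containing the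
rescaled centre of `p`.  For a walk leaving the hexagon at `{p,q}` this is the side of the root: the
inner continuum component of the hexagon together with every lobe of `Ω` attached to it across other
arcs of the hexagon boundary; when the walk then reaches the far marked point without returning, the
root side is bounded by the crosscut and the SHORT arc of `∂Ω` (diameter `→ 0` with the level), and
its complement side is the Jordan domain bounded by the crosscut and the long arc. -/
def gateSide (Ω : Set ℂ) (δ : ℝ) (c : HexVertex) (n : ℕ) (p q : HexVertex) : Set ℂ :=
  connectedComponentIn (Ω \ gateCut Ω δ c n p q) ((δ : ℂ) * hexCenter p)

/-- The lattice shadow of the root side: honeycomb vertices whose rescaled centre lies in it. -/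
def sideVerts (Ω : Set ℂ) (δ : ℝ) (c : HexVertex) (n : ℕ) (p q : HexVertex) : Set HexVertex :=
  {v | (δ : ℂ) * hexCenter v ∈ gateSide Ω δ c n p q}

/-- A CLEAN FLAT WINDOW of radius `ρ` at the gate `{p,q}` relative to the root-side vertex set `S`:
the closed `ρ`-ball about the rescaled centre of `q` lies in `Ω`, `q` is one signed row beyond `p` in
some orientation `k`, and inside the ball membership in `S` is EXACTLY the half-lattice condition
`rowOf k · ≤ rowOf k p` — so the far side is, near its new root `q`, the exact half-lattice
`{rowOf k · ≥ rowOf k p + 1}` above a flat zigzag side lying on a `𝕋`-line: the root clause of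
`HexObservableLimitR` in orientation `ζ^k` (hexagon corners and `∂Ω` are then automatically
`ρ`-far from the gate). -/
def HasCleanWindow (Ω : Set ℂ) (δ ρ : ℝ) (S : Set HexVertex) (p q : HexVertex) : Prop :=
  closedBall ((δ : ℂ) * hexCenter q) ρ ⊆ Ω ∧
    ∃ k : Fin 6, rowOf k q = rowOf k p + 1 ∧
      ∀ x : HexVertex, (δ : ℂ) * hexCenter x ∈ ball ((δ : ℂ) * hexCenter q) ρ →
        (x ∈ S ↔ rowOf k x ≤ rowOf k p)

/-- `l` makes its FIRST EXIT from the lattice hexagon of size `n` around `c` at index `m` through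
the edge `{p, q}`: the first `m` entries lie in the hexagon, the last of them is `p`, the next entry
`q` lies outside (so `m`, `p`, `q` are determined by `l` and `n`). -/
def IsFirstExit (c : HexVertex) (n : ℕ) (l : List HexVertex) (m : ℕ) (p q : HexVertex) : Prop :=
  (l.take m).getLast? = some p ∧ (l.drop m).head? = some q ∧
    (∀ v ∈ l.take m, v ∈ hexBall c n) ∧ q ∉ hexBall c n

/-- A GOOD GATE of the vertex list `l` (read from its initial vertex `c = l.head`) at level `n` in
the scale window `[r, R]` with window radius `ρ`: `l` first leaves the lattice hexagon of size `n`
around `c` through `{p, q}`, NEVER RETURNS to the root side of the crosscut through that gate (single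
crossing), and the gate carries a clean flat window. -/
def IsGoodGate (Ω : Set ℂ) (δ r R ρ : ℝ) (c : HexVertex) (l : List HexVertex) (n m : ℕ)
    (p q : HexVertex) : Prop :=
  r ≤ n * δ ∧ n * δ ≤ R ∧ IsFirstExit c n l m p q ∧
    (∀ v ∈ l.drop m, v ∉ sideVerts Ω δ c n p q) ∧
    HasCleanWindow Ω δ ρ (sideVerts Ω δ c n p q) p q

/-- The FIRST good gate: a good gate at the minimal good level (one gate per list, if any: at a
given level the first-exit data are determined by the list). -/
def IsFirstGoodGate (Ω : Set ℂ) (δ r R ρ : ℝ) (c : HexVertex) (l : List HexVertex) (n m : ℕ)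
    (p q : HexVertex) : Prop :=
  IsGoodGate Ω δ r R ρ c l n m p q ∧
    ∀ (n' m' : ℕ) (p' q' : HexVertex), IsGoodGate Ω δ r R ρ c l n' m' p' q' → n ≤ n'

/-- `l` has a good gate at some level of the window. -/
def GoodRenewalAt (Ω : Set ℂ) (δ r R ρ : ℝ) (c : HexVertex) (l : List HexVertex) : Prop :=
  ∃ (n m : ℕ) (p q : HexVertex), IsGoodGate Ω δ r R ρ c l n m p q

/-- The critical SAW weight `x_c^{ℓ}` on the SAWs of `Ω_δ` from `u` to `v` that AVOID the vertex
set `S` (in the line: the union of the two root sides): the un-normalised middle law. -/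
def carvedWeight (Ω : Set ℂ) (δ : ℝ) (S : Set HexVertex) (u v : HexVertex) :
    Measure (HexDomainSAW Ω δ u v) :=
  (hexSAWWeight Ω δ u v).restrict {γ | ∀ x ∈ γ.walk.support, x ∉ S}

/-- The CARVED LAW: the critical SAW of `Ω_δ` from `u` to `v` conditioned to avoid `S`, i.e. the
critical SAW law of the lattice domain `Ω_δ ∖ S` (junk `0` if there is no such walk). -/
def carvedLaw (Ω : Set ℂ) (δ : ℝ) (S : Set HexVertex) (u v : HexVertex) :
    Measure (HexDomainSAW Ω δ u v) :=
  (carvedWeight Ω δ S u v Set.univ)⁻¹ • carvedWeight Ω δ S u v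

/-- `rowOf 0` is the row function `v ↦ v.1 1` of `HexObservableLimitR`'s lattice clause. -/
theorem rowOf_zero : ∀ (v : HexVertex), rowOf 0 v = v.1 1 := by
  intro v
  simp [rowOf, rowCoord]

end Summit.CriticalPhenomena.SAWScalingLimit.Theorems.ObservableToSLER.BridgeGate

end
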